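import Summits.ValiantsHypothesis.ValiantsHypothesis.Theses.SOSTau

/-!
# Disproof of `SOSTau.HutchinsonMagnification` (stmt-ValiantsHypothesis-18749) — findings

Crux (verbatim): `HutchinsonMagnification : Prop :=
  (∃ η > 0, ∃ n₀, ∀ n ≥ n₀, ∀ s a g, Σ_i C(a_i)·g_i² = (tavenasV n).map (Int.castRingHom ℝ) → η·2^n ≤ Σ_i |supp g_i|)
  → ValiantsHypothesis` — linear real sparse-SOS hardness of Tavenas' `V_n` implies `VP_ℂ ≠ VNP_ℂ`
(Dutta 2021 Thm 2 for the tree's witness).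

## STATUS after cycle 1 (refuter-cdisprove-stmt-ValiantsHypothesis-18749-0, 2026-08-17): NO DISPROOF CAN EXIST

The crux is a THEOREM of the tree: the complete candidate
`Cruxes/HutchinsonMagnification/HutchinsonMagnificationCandidate.lean`
(planner-cruxidea-…-2-0; theorem `…Cruxes.HutchinsonMagnification.DefinabilityProjection.hutchinsonMagnification :
Summit.ValiantsHypothesis.ValiantsHypothesis.Theses.SOSTau.HutchinsonMagnification`, 876 lines, importing only
LANDED modules) was RE-CHECKED INDEPENDENTLY by this seat on the farm: rc 0, errors [], warnings [], sorries 0,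
`#print axioms hutchinsonMagnification` = {propext, Classical.choice, Quot.sound} (no `sorryAx`, no
`Lean.ofReduceBool`, no user axioms anywhere in the import closure), audit `proof-of-item … closed: true` for the
crux BY NAME (and for supports 18750 `ComplexToRealSOS`, 18751 `CollapseCheapComplexSOS`). Consequently
`¬ HutchinsonMagnification` is itself refutable and every counterexample search is moot; what this file records is
(a) the exact shape a kill would have had (`not_hutchinsonMagnification_iff`: a kill is PRECISELY
"linear SOS-hardness of `V_n` ∧ `VP_ℂ = VNP_ℂ`", i.e. it needs ¬VH), (b) the load-bearing analysis of the one
hypothesis that can be dropped without touching `VP/VNP` (`0 < η`: dropping it turns the crux into the summit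
statement itself, `withoutPos_iff_valiantsHypothesis`), (c) the boundary of the antecedent's parameter space
(`eta_le_two`: only `η ≤ 2` is admissible, by the universal two-square representation `f = ¼(f+1)² − ¼(f−1)²`,
`two_square_rep`), (d) the degenerate witness `s = 0` is excluded (`no_rep_fin_zero`).

## Attacks run (cycle 1) and why each is empty
* outright `¬crux`: equivalent to `HutchinsonSOSHard ∧ VP ℂ = VNP ℂ` (`not_hutchinsonMagnification_iff`) — needs a
  DISPROOF of Valiant's hypothesis; and the crux is now kernel-proved, so this conjunction is refutable.
* vacuity of the antecedent (a cheap real SOS representation of `V_n`, support `o(2^n)` — the theta/Gauss-identity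
  fear of the TARGET 18747): would make the crux vacuously true, not false; it is an asymptotic statement with no
  finite falsifier (`∃ η ∃ n₀ ∀ n ≥ n₀`), the trivial bounds are `√(2^{n+1}) ≲ S ≤ 2^{n+1}` (`eta_le_two` is the upper
  one), and it is the live risk of items 18747/18748, not of this crux — not pursued here (anti-leakage).
* typed obstacles to Dutta's chain (digit-lift ∈ VNP_ℂ with 2^{2n+1}-bit constants; radix/`d = 2^n − 1` shape; VSBR
  middle cut for the tree's `ArithCircuit`; ℂ→ℝ realification): all DISCHARGED by the candidate (hex radix 16 at
  levels n = 4m, transcript witness over Tavenas' landed circuit, `exists_bilin_of_two_le_totalDegree`,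
  `stub_polarisedSOS`, `dk_partA`, Lemma-10 realification ×3 ≤ ×4) — nothing left to attack.
* junk audit of the statement's constants: `VP`/`VNP` are Bürgisser's classes with FREE constants (`complexity` =
  `L_ℂ` up to ×3), `ValiantsHypothesis := VP ℂ ≠ VNP ℂ`; `tavenasV n` has exactly `2^n` nonzero coefficients and
  `2^n − 1` distinct real roots (tree) — no junk inhabitant makes either side degenerate.

Targets (lead's stuck stubs): none in payload. Negative lemmas landed: none needed (crux proved).
-/

set_option linter.dupNamespace false

noncomputable section

namespace Summit.ValiantsHypothesis.ValiantsHypothesis.Cruxes.HutchinsonMagnification.Disproof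

open Polynomial
open Literature.Computability.AlgebraicComplexity
open Summit.ValiantsHypothesis.ValiantsHypothesis.Theses.SOSTau

/-! ## (a) The structural obstruction: a kill of the crux is exactly ¬VH plus the target -/

/-- The crux is literally "target `HutchinsonSOSHard` ⇒ summit" (definitional unfolding). -/
theorem hutchinsonMagnification_iff :
    HutchinsonMagnification ↔ (HutchinsonSOSHard → ValiantsHypothesis) :=
  Iff.rfl

/-- **Why no refutation can be landed short of disproving Valiant's hypothesis**: `¬ crux` is equivalent to
linear real SOS-hardness of `V_n` TOGETHER WITH the collapse `VP_ℂ = VNP_ℂ`. -/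
theorem not_hutchinsonMagnification_iff :
    ¬ HutchinsonMagnification ↔ (HutchinsonSOSHard ∧ VP ℂ = VNP ℂ) := by
  show ¬ (HutchinsonSOSHard → VP ℂ ≠ VNP ℂ) ↔ _
  rw [Classical.not_imp, not_ne_iff]

/-- In particular any proof of `¬ crux` would hand over `VP_ℂ = VNP_ℂ`. -/
theorem vp_eq_vnp_of_not_hutchinsonMagnification (h : ¬ HutchinsonMagnification) : VP ℂ = VNP ℂ :=
  (not_hutchinsonMagnification_iff.1 h).2

/-! ## (b) Load-bearing analysis of `0 < η` (the only hypothesis droppable without touching `VP/VNP`) -/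

/-- The crux with the positivity side condition `0 < η` DROPPED from its antecedent. -/
def HutchinsonMagnificationWithoutPos : Prop :=
  (∃ η : ℝ, ∃ n₀ : ℕ, ∀ n : ℕ, n₀ ≤ n → ∀ (s : ℕ) (a : Fin s → ℝ) (g : Fin s → Polynomial ℝ),
    (∑ i, Polynomial.C (a i) * g i ^ 2) = (tavenasV n).map (Int.castRingHom ℝ) →
      η * 2 ^ n ≤ ∑ i, ((g i).support.card : ℝ)) → ValiantsHypothesis

/-- Without `0 < η` the antecedent is provable outright (`η := 0`). -/
theorem antecedent_without_pos_holds :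
    ∃ η : ℝ, ∃ n₀ : ℕ, ∀ n : ℕ, n₀ ≤ n → ∀ (s : ℕ) (a : Fin s → ℝ) (g : Fin s → Polynomial ℝ),
      (∑ i, Polynomial.C (a i) * g i ^ 2) = (tavenasV n).map (Int.castRingHom ℝ) →
        η * 2 ^ n ≤ ∑ i, ((g i).support.card : ℝ) :=
  ⟨0, 0, fun n _ s a g _ => by rw [zero_mul]; positivity⟩

/-- **`0 < η` is load-bearing**: dropping it turns the crux into the summit statement itself (so
`hutchinsonMagnification_false_without_pos` would be `¬ ValiantsHypothesis` — not landable, as it must be). -/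
theorem withoutPos_iff_valiantsHypothesis : HutchinsonMagnificationWithoutPos ↔ ValiantsHypothesis :=
  ⟨fun h => h antecedent_without_pos_holds, fun h _ => h⟩

/-! ## (c) Boundary of the antecedent's parameter space: only `η ≤ 2` is admissible -/

/-- The universal weighted two-square representation `f = ¼ (f + 1)² − ¼ (f − 1)²`, in the crux's format. -/
theorem two_square_rep (f : ℝ[X]) :
    (∑ i : Fin 2, C ((![1 / 4, -1 / 4] : Fin 2 → ℝ) i) * ((![f + 1, f - 1] : Fin 2 → ℝ[X]) i) ^ 2) = f := by
  rw [Fin.sum_univ_two]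
  simp only [Matrix.cons_val_zero, Matrix.cons_val_one]
  have h1 : C (1 / 4 : ℝ) * 4 = (1 : ℝ[X]) := by
    rw [show (4 : ℝ[X]) = C 4 from (map_ofNat C 4).symm, ← map_mul]
    norm_num
  have h2 : C (-1 / 4 : ℝ) = -C (1 / 4 : ℝ) := by
    rw [← map_neg]; congr 1; ring
  linear_combination (f - 1) ^ 2 * h2 + f * h1

/-- Support bound for the two squares at `f = V_n`: each has at most `2^n` monomials. -/
theorem card_support_map_tavenasV_add_C_le (n : ℕ) (c : ℝ) :
    ((tavenasV n).map (Int.castRingHom ℝ) + C c).support.card ≤ 2 ^ n := by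
  have hV : ((tavenasV n).map (Int.castRingHom ℝ)).natDegree < 2 ^ n :=
    lt_of_le_of_lt natDegree_map_le (natDegree_tavenasV_lt n)
  have hdeg : ((tavenasV n).map (Int.castRingHom ℝ) + C c).natDegree < 2 ^ n :=
    lt_of_le_of_lt (natDegree_add_le_of_degree_le le_rfl (by simp)) hV
  exact (card_supp_le_succ_natDegree _).trans hdeg

/-- **Boundary lemma**: every pair `(η, n₀)` admissible in the crux's antecedent (= in the target
`HutchinsonSOSHard`) has `η ≤ 2` — witnessed at level `n₀` by the two-square representation of `V_{n₀}` of
support-sum `≤ 2^{n₀} + 2^{n₀}`. So the antecedent ranges over `η ∈ (0, 2]`; the trivial bound cannot be beaten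
by a constant factor argument alone. -/
theorem eta_le_two {η : ℝ} {n₀ : ℕ}
    (H : ∀ n : ℕ, n₀ ≤ n → ∀ (s : ℕ) (a : Fin s → ℝ) (g : Fin s → Polynomial ℝ),
      (∑ i, Polynomial.C (a i) * g i ^ 2) = (tavenasV n).map (Int.castRingHom ℝ) →
        η * 2 ^ n ≤ ∑ i, ((g i).support.card : ℝ)) :
    η ≤ 2 := by
  set f : ℝ[X] := (tavenasV n₀).map (Int.castRingHom ℝ) with hf
  have key := H n₀ le_rfl 2 ![1 / 4, -1 / 4] ![f + 1, f - 1] (two_square_rep f)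
  rw [Fin.sum_univ_two] at key
  simp only [Matrix.cons_val_zero, Matrix.cons_val_one] at key
  have h₁ : ((f + 1).support.card : ℝ) ≤ 2 ^ n₀ := by
    have := card_support_map_tavenasV_add_C_le n₀ 1
    rw [map_one] at this
    exact_mod_cast this
  have h₂ : ((f - 1).support.card : ℝ) ≤ 2 ^ n₀ := by
    have := card_support_map_tavenasV_add_C_le n₀ (-1)
    rw [map_neg, map_one, ← sub_eq_add_neg] at this
    exact_mod_cast this
  have h2n : (0 : ℝ) < 2 ^ n₀ := by positivity
  nlinarith

/-- Hence the target/antecedent with any `η > 2` is FALSE (a refuted strengthening, by explicit witness). -/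
theorem not_antecedent_of_two_lt {η : ℝ} (hη : 2 < η) (n₀ : ℕ) :
    ¬ ∀ n : ℕ, n₀ ≤ n → ∀ (s : ℕ) (a : Fin s → ℝ) (g : Fin s → Polynomial ℝ),
      (∑ i, Polynomial.C (a i) * g i ^ 2) = (tavenasV n).map (Int.castRingHom ℝ) →
        η * 2 ^ n ≤ ∑ i, ((g i).support.card : ℝ) :=
  fun H => absurd (eta_le_two H) (not_le.2 hη)

/-! ## (d) Degenerate witnesses -/

/-- `s = 0` (the empty representation) never represents `V_n ≠ 0`. -/
theorem no_rep_fin_zero (n : ℕ) (a : Fin 0 → ℝ) (g : Fin 0 → ℝ[X]) :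
    (∑ i, C (a i) * g i ^ 2) ≠ (tavenasV n).map (Int.castRingHom ℝ) := by
  rw [Finset.univ_eq_empty, Finset.sum_empty]
  exact (map_tavenasV_ne_zero n).symm

end Summit.ValiantsHypothesis.ValiantsHypothesis.Cruxes.HutchinsonMagnification.Disproof
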